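import Summits.BirchSwinnertonDyer.BirchSwinnertonDyer.Theorems.PrintCFramSqrtEndomorphismOnLeaf
import HarnessLib

/-!
# Route `PrintCFram`, crux C2 `BottomClassIndexLawFiveLe` (stmt-BirchSwinnertonDyer-20372), line `eisenstein-resource-bdp-line`:
# the RATIONAL LINE `Φ_ℚ ≤ W[p](ℚ̄)` of a CM curve at a CM-ramified prime `p ≥ 5` — a `Γ_ℚ`-stable subgroup of order `p`
# (the kernel of the certified cyclic `p`-isogeny `W → W^{(−p)}` over `ℚ`), for every member of the six leaf classes
# (cell `bsd-print-cfram`, width seat `bsd-line-cfram-p1-w2` g3; helper `--supports` 20372; THEOREMS ONLY, 0 facts, 0 definitions)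

HONEST FRAMING. Nothing about BSD is proved; no stub is closed. LEAD g3/g4's reduction of the registered stubs
`stub_torsion_cmRamified` / `stub_invariantMatch_cmRamified` (v3, sha16 305336f1dc271bb6) to per-frame «residual LINE DATA»
(`…EisensteinTorsionSocket.stub_torsion_cmRamified_of_line`, `…EisensteinAlgebraicMuRefined…`) asks for a `Γ_{K''}`-stable line in
`W[p]` over the `p`-split Heegner field `K''`. The dictionary `ℚ → K''` exists in the tree (CHL
`CumulativeHeegnerInclusionAtThreeLineBaseChange.exists_stableSubgroup_corr`); this file supplies its ℚ-SIDE INPUT on the CM-ramified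
class, with NO use of `√−p` (which is not in `ℚ` or `K''`):

* `exists_stableLine_of_cert` — ENGINE, any field `F` of characteristic `0`: a checked CM twist certificate `c` (tree
  `DeuringCert.IsCMTwistCert c d`: the cyclic `|d|`-isogeny `E_c → E_c^{(d)}` by an explicit formula, `IsogenyFormula.toIsogeny`) and
  any elliptic `V/F` with `j(V) = j(E_c)` give a `Γ_F`-stable subgroup of `V(F̄)` of order `deg U = |d|`: the kernel of
  `ψ^{(D)} ∘ ι`, where `C • V = E_c^{(D)}` (`exists_variableChange_eq_quadraticTwist_of_j_eq`), `ι : V ≅ E_c^{(D)}`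
  (`Rubin1987.exists_isogeny_bijective_of_smul_eq`) and `ψ^{(D)}` is the twisted isogeny (`Isogeny.quadraticTwist`,
  `degree_quadraticTwist`, `IsogenyFormula.degree_toIsogeny`). This is the p1 seat's `exists_endomorphism_of_j_eq` WITHOUT the
  composition back to an endomorphism (so without `θ = √d ∈ F`).
* `exists_stableLine_geomTorsion_of_card_eq` — a stable subgroup of `E(F̄)` of prime order `p` is a stable subgroup of `E[p]`.
* `exists_rationalLine_of_cmRamified` — **on the leaf**: for `W/ℚ` with CM and `p ≥ 5` CM-ramified (`p ∈ {7,11,19,43,67,163}`,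
  seven `j`-invariants), a `Γ_ℚ`-stable `Φ ≤ W[p](ℚ̄)` with `#Φ = p` (case by case over the certificates `cert7`, `cert28`, `cert11`,
  `cert19`, `cert43`, `cert67`, `cert163`).

Companion (this seat): the bottom-layer non-triviality of `D_𝔓` on `W[p]/Φ` and the `K''`-side package. BSD is not proved by any
of this; no summit statement is proved by this seat.

References: Silverman, *Advanced Topics* II §2 Prop. 2.3.1 [SilvermanAdvancedTopics1994]; Silverman *AEC* III.4.8, III.4.10, X.5.4
[SilvermanAEC2009]; Cremona, *Algorithms* §3.9 [CremonaAlgorithms1997]; Greenberg–Vatsal 2000 §2 p. 28 (the line `Φ`) [GreenbergVatsal2000].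
-/

-- the summit namespace `Summit.BirchSwinnertonDyer.BirchSwinnertonDyer` repeats the problem name by design (D-0017)
set_option linter.dupNamespace false
set_option autoImplicit false

noncomputable section

open scoped Classical

open Polynomial WeierstrassCurve NumberField Field
  Literature.NumberTheory.EllipticCurves
  Literature.NumberTheory.EllipticCurves.PolyCert
  Literature.NumberTheory.EllipticCurves.CMIsogenyCert
  Literature.NumberTheory.EllipticCurves.DeuringModels
  Literature.NumberTheory.EllipticCurves.Rank1Residual
  Literature.NumberTheory.QuadraticFields.Quadratic
  Summit.BirchSwinnertonDyer.Rank1Residual.X12.O11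
  Summit.BirchSwinnertonDyer.BirchSwinnertonDyer.Theorems.PrintCFram.SqrtEndomorphism

namespace Summit.BirchSwinnertonDyer.BirchSwinnertonDyer.Theorems.PrintCFram.RationalLine

/-! ## §1 Engine: a stable subgroup of order `deg U` from a CM twist certificate, over any field of characteristic `0` -/

section Engine

variable {c : IsogenyCert} {d : ℤ}

/-- **A `Γ_F`-stable subgroup of `V(F̄)` of order `deg U` from a checked CM twist certificate** (any field `F` of characteristic
`0`, any elliptic `V/F` with the model's `j`-invariant `n ≠ 0, 1728`): the kernel of `ψ^{(D)} ∘ ι : V → E_c^{(D)} → E_c'^{(D)}`,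
where `ψ = φ_c : E_c → E_c'` is the certified isogeny read over `F`, `C • V = E_c^{(D)}` and `ι` is the bijective isogeny of `C`.
No square root of `d` is needed. [cite: SilvermanAEC2009, Thm. III.4.8, Thm. III.4.10(a),(c), X.5 Prop. 5.4 and Cor. 5.4.1]
[cite: CremonaAlgorithms1997, §3.9 (p. 87)] -/
theorem exists_stableLine_of_cert (hc : c.check = true) (H : DeuringCert.IsCMTwistCert c d) (cop : CoprimeCert) {k' : ℕ}
    (hcop : c.checkCoprime cop k' = true) (hℓ : cop.ℓ.Prime) (hd0 : d ≠ 0) {n : ℤ}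
    (hmodel : (DeuringCert.curve c).c₄ ^ 3 = n * (DeuringCert.curve c).Δ)
    (hΔ : (DeuringCert.curve c).Δ ≠ 0) (hn0 : n ≠ 0) (hn1728 : n ≠ 1728)
    {F : Type} [Field F] [CharZero F] (V : WeierstrassCurve F) [V.IsElliptic] (hj : V.j = (n : F)) :
    ∃ Φ : AddSubgroup V.geomPoints, (∀ σ : absoluteGaloisGroup F, ∀ P ∈ Φ, σ • P ∈ Φ) ∧
      Nat.card Φ = c.U.length - 1 := by
  haveI : NeZero (2 : F) := ⟨two_ne_zero⟩
  set E := (DeuringCert.curve c).map (Int.castRingHom F) with hEdef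
  set E' := (DeuringCert.curve' c).map (Int.castRingHom F) with hE'def
  haveI hE : E.IsElliptic := isElliptic_map_intCast (DeuringCert.curve c) F hΔ
  haveI : E.IsCharNeTwoNF := isCharNeTwoNF_of_cert H F
  haveI : E'.IsCharNeTwoNF := by
    refine ⟨?_, ?_⟩
    · change (Int.castRingHom F) c.a₁' = 0; rw [H.a₁', map_zero]
    · change (Int.castRingHom F) c.a₃' = 0; rw [H.a₃', map_zero]
  let φ : IsogenyFormula E E' := c.toFormula hc E E' rfl rfl
  have HK : φ.IsTwistBy (d : F) :=
    { a₁ := by change (Int.castRingHom F) c.a₁ = 0; rw [H.a₁, map_zero]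
      a₂ := by change (Int.castRingHom F) c.a₂ = 0; rw [H.a₂, map_zero]
      a₃ := by change (Int.castRingHom F) c.a₃ = 0; rw [H.a₃, map_zero]
      a₁' := by change (Int.castRingHom F) c.a₁' = 0; rw [H.a₁', map_zero]
      a₂' := by change (Int.castRingHom F) c.a₂' = 0; rw [H.a₂', map_zero]
      a₃' := by change (Int.castRingHom F) c.a₃' = 0; rw [H.a₃', map_zero]
      a₄' := by
        change (Int.castRingHom F) c.a₄' = _ * (Int.castRingHom F) c.a₄
        rw [H.a₄', map_mul, map_pow, eq_intCast]
      a₆' := by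
        change (Int.castRingHom F) c.a₆' = _ * (Int.castRingHom F) c.a₆
        rw [H.a₆', map_mul, map_pow, eq_intCast]
      T := by change (ofList c.T : F[X]) = 0; rw [H.T]; rfl }
  have hU : φ.U = (ofList c.U : F[X]) := rfl
  have hh : φ.h = (ofList c.h : F[X]) := rfl
  have hcopF : IsCoprime (φ.U.map (algebraMap F (AlgebraicClosure F))) (φ.h.map (algebraMap F (AlgebraicClosure F))) := by
    rw [hU, hh, IsogenyCert.map_ofList, IsogenyCert.map_ofList]
    exact IsogenyCert.isCoprime_of_checkCoprime hcop hℓ _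
  haveI hE' : E'.IsElliptic := by
    -- `E' = E^{(d)}` has discriminant `d⁶ Δ(E)`; read from the certificate's twist relation
    rw [WeierstrassCurve.isElliptic_iff, isUnit_iff_ne_zero]
    have hΔE : E.Δ ≠ 0 := by rw [← WeierstrassCurve.coe_Δ']; exact E.Δ'.ne_zero
    have hdF : (d : F) ≠ 0 := by exact_mod_cast hd0
    have e : E'.Δ = (d : F) ^ 6 * E.Δ := by
      have h1 : E'.a₁ = 0 := HK.a₁'
      have h2 : E'.a₂ = 0 := HK.a₂'
      have h3 : E'.a₃ = 0 := HK.a₃'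
      have h4 : E'.a₄ = (d : F) ^ 2 * E.a₄ := HK.a₄'
      have h6 : E'.a₆ = (d : F) ^ 3 * E.a₆ := HK.a₆'
      have g1 : E.a₁ = 0 := HK.a₁
      have g2 : E.a₂ = 0 := HK.a₂
      have g3 : E.a₃ = 0 := HK.a₃
      simp only [WeierstrassCurve.Δ, WeierstrassCurve.b₂, WeierstrassCurve.b₄, WeierstrassCurve.b₆,
        WeierstrassCurve.b₈, h1, h2, h3, h4, h6, g1, g2, g3]
      ring
    rw [e]
    exact mul_ne_zero (pow_ne_zero 6 hdF) hΔE
  -- the certified isogeny over `F` and its degree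
  set ψ : Isogeny E E' := φ.toIsogeny with hψ
  have hdeg : ψ.degree = c.U.length - 1 := by
    rw [hψ, φ.degree_toIsogeny hcopF, hU]
    exact IsogenyCert.natDegree_ofList_eq c.U (by rw [H.U_top]; exact one_ne_zero)
  -- `V ≅ E^{(D)}` over `F`
  have hjE : E.j = (n : F) := j_map_intCast_of_c₄_pow (DeuringCert.curve c) F n hmodel
  obtain ⟨D, hD, C, hC⟩ := exists_variableChange_eq_quadraticTwist_of_j_eq (W := V) (E := E) (by rw [hj, hjE])
    (by rw [hjE]; exact_mod_cast hn0) (by rw [hjE]; exact_mod_cast hn1728)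
  obtain ⟨ι, hι⟩ := Rubin1987.exists_isogeny_bijective_of_smul_eq C hC
  set ψD := ψ.quadraticTwist hD with hψD
  -- the kernel of `ψ^{(D)} ∘ ι`
  let g : V.geomPoints →+ (E'.quadraticTwist D).geomPoints := ψD.toAddMonoidHom.comp ι.toAddMonoidHom
  refine ⟨g.ker, fun σ P hP ↦ ?_, ?_⟩
  · rw [AddMonoidHom.mem_ker] at hP ⊢
    change ψD (ι (σ • P)) = 0
    rw [ι.map_smul, ψD.map_smul, show ψD (ι P) = 0 from hP, smul_zero]
  · rw [← hdeg, ← Isogeny.degree_quadraticTwist ψ hD, ← hψD]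
    unfold Isogeny.degree
    let e : V.geomPoints ≃ (E.quadraticTwist D).geomPoints := Equiv.ofBijective ι hι
    refine Nat.card_congr (Equiv.subtypeEquiv e fun P ↦ ?_)
    change ψD (ι P) = 0 ↔ ψD (e P) = 0
    rfl

end Engine

/-! ## §2 A stable subgroup of prime order sits inside `E[p]` -/

section Torsion

variable {F : Type} [Field F] (V : WeierstrassCurve F) {p : ℕ} [hp : Fact p.Prime]

omit hp in
/-- A subgroup of `E(F̄)` of order `p` is killed by `p`, hence lies in `E[p]`. [folklore] -/
theorem le_geomTorsion_of_card_eq {Φ : AddSubgroup V.geomPoints} (hcard : Nat.card Φ = p) :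
    Φ ≤ V.geomTorsion (p : ℤ) := by
  intro P hP
  apply AddSubgroup.torsionBy.nsmul_iff.mpr
  have h := AddSubgroup.addOrderOf_dvd_natCard Φ hP
  rw [hcard] at h
  exact addOrderOf_dvd_iff_nsmul_eq_zero.mp h

omit hp in
/-- **A `Γ_F`-stable subgroup of `E(F̄)` of order `p` as a `Γ_F`-stable subgroup of `E[p]`** (pulled back along the inclusion
`E[p] ⊆ E(F̄)`; same order). [folklore] -/
theorem exists_stableLine_geomTorsion_of_card_eq {Φ : AddSubgroup V.geomPoints}
    (hstab : ∀ σ : absoluteGaloisGroup F, ∀ P ∈ Φ, σ • P ∈ Φ) (hcard : Nat.card Φ = p) :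
    ∃ Ψ : AddSubgroup (V.geomTorsion (p : ℤ)), (∀ σ : absoluteGaloisGroup F, ∀ P ∈ Ψ, σ • P ∈ Ψ) ∧
      Nat.card Ψ = p ∧ Ψ.map (V.geomTorsion (p : ℤ)).subtype = Φ := by
  have hle : Φ ≤ V.geomTorsion (p : ℤ) := le_geomTorsion_of_card_eq V hcard
  refine ⟨Φ.addSubgroupOf (V.geomTorsion (p : ℤ)), fun σ P hP ↦ ?_, ?_, ?_⟩
  · rw [AddSubgroup.mem_addSubgroupOf] at hP ⊢
    rw [AddSubgroup.torsionBy.coe_smul]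
    exact hstab σ _ hP
  · exact (Nat.card_congr (AddSubgroup.addSubgroupOfEquivOfLe hle).toEquiv).trans hcard
  · exact AddSubgroup.map_addSubgroupOf_eq_of_le hle

end Torsion

/-! ## §3 On the leaf: the rational line of a CM curve at a CM-ramified `p ≥ 5` -/

section Leaf

variable (W : WeierstrassCurve ℚ) [W.IsElliptic] (p : ℕ) [hp : Fact p.Prime]

/-- **The RATIONAL LINE of a CM curve at a CM-ramified prime `p ≥ 5`.** For `W/ℚ` with CM and `p ≥ 5` ramified in the CM field
(`p ∈ {7, 11, 19, 43, 67, 163}`; `j(W)` one of the seven leaf values) there is a `Γ_ℚ`-stable subgroup `Φ ≤ W[p](ℚ̄)` of order `p` —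
the kernel `W[𝔭]` of the cyclic `p`-isogeny `W → W^{(−p)}` defined over `ℚ`, certified by the tree's `cert7`, `cert28`, `cert11`,
`cert19`, `cert43`, `cert67`, `cert163` (Silverman, *Advanced Topics* II §2: `E → E/E[𝔭]`). Case by case over the leaf
`j`-invariants, exactly as `SqrtEndomorphism.exists_sqrt_endomorphism_of_leaf` but over `ℚ` and without `√−p`.
[cite: SilvermanAdvancedTopics1994, II §2 Prop. 2.3.1 and App. A §3] [cite: SilvermanAEC2009, Thm. III.4.8 and X.5 Prop. 5.4] -/
theorem exists_rationalLine_of_cmRamified (hCM : W.HasCM) (h5 : 5 ≤ p) (hram : CMRamified W p) :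
    ∃ Φ : AddSubgroup (W.geomTorsion (p : ℤ)), (∀ σ : absoluteGaloisGroup ℚ, ∀ P ∈ Φ, σ • P ∈ Φ) ∧ Nat.card Φ = p := by
  -- it suffices to produce a stable subgroup of `W(ℚ̄)` of order `p`
  suffices h : ∃ Φ : AddSubgroup W.geomPoints, (∀ σ : absoluteGaloisGroup ℚ, ∀ P ∈ Φ, σ • P ∈ Φ) ∧ Nat.card Φ = p by
    obtain ⟨Φ, hstab, hcard⟩ := h
    obtain ⟨Ψ, hΨ, hΨcard, -⟩ := exists_stableLine_geomTorsion_of_card_eq W hstab hcard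
    exact ⟨Ψ, hΨ, hΨcard⟩
  have hj13 : W.j ∈ cmJInvariants := (hasCM_iff_j_mem_holds W).mp hCM
  obtain ⟨-, hd, -⟩ := LeafInterface.leaf_arith W p hCM h5 hram
  simp only [cmJInvariants, Finset.mem_insert, Finset.mem_singleton] at hj13
  rcases hj13 with h | h | h | h | h | h | h | h | h | h | h | h | h <;>
    rw [h] at hd <;> norm_num [cmFieldDiscrOfJ] at hd
  -- `d_K ∈ {-3, -4}` contradicts `5 ≤ p`; eight `j` remain
  all_goals first | (exfalso; omega) | skip
  · -- j = -3375 (p = 7)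
    obtain rfl : p = 7 := by omega
    obtain ⟨Φ, h1, h3⟩ := exists_stableLine_of_cert (IsogenyCert.check_of_checkFast checkFast_cert7)
      isCMTwistCert_cert7 cert7Cop checkCoprime_cert7 (by rw [show cert7Cop.ℓ = 10007 from rfl]; norm_num) (by norm_num)
      model7.2 (by rw [model7.1]; norm_num) (by norm_num) (by norm_num) W (by rw [h]; norm_num)
    exact ⟨Φ, h1, by rw [h3]; decide⟩
  · -- j = 8000: `d_K = -8 = -p` is impossible for a prime `p`
    exfalso
    have hp8 : p = 8 := by omega
    exact absurd hp.out (by rw [hp8]; norm_num)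
  · -- j = -32768, p = 11
    obtain rfl : p = 11 := by omega
    obtain ⟨Φ, h1, h3⟩ := exists_stableLine_of_cert (IsogenyCert.check_of_checkFast checkFast_cert11)
      isCMTwistCert_cert11 cert11Cop checkCoprime_cert11 (by rw [show cert11Cop.ℓ = 10007 from rfl]; norm_num) (by norm_num)
      model11.2 (by rw [model11.1]; norm_num) (by norm_num) (by norm_num) W (by rw [h]; norm_num)
    exact ⟨Φ, h1, by rw [h3]; decide⟩
  · -- j = -884736, p = 19
    obtain rfl : p = 19 := by omega
    obtain ⟨Φ, h1, h3⟩ := exists_stableLine_of_cert (IsogenyCert.check_of_checkFast checkFast_cert19)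
      isCMTwistCert_cert19 cert19Cop checkCoprime_cert19 (by rw [show cert19Cop.ℓ = 10007 from rfl]; norm_num) (by norm_num)
      model19.2 (by rw [model19.1]; norm_num) (by norm_num) (by norm_num) W (by rw [h]; norm_num)
    exact ⟨Φ, h1, by rw [h3]; decide⟩
  · -- j = 16581375, p = 7
    obtain rfl : p = 7 := by omega
    obtain ⟨Φ, h1, h3⟩ := exists_stableLine_of_cert (IsogenyCert.check_of_checkFast checkFast_cert28)
      isCMTwistCert_cert28 cert28Cop checkCoprime_cert28 (by rw [show cert28Cop.ℓ = 10007 from rfl]; norm_num) (by norm_num)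
      model28.2 (by rw [model28.1]; norm_num) (by norm_num) (by norm_num) W (by rw [h]; norm_num)
    exact ⟨Φ, h1, by rw [h3]; decide⟩
  · -- j = -884736000, p = 43
    obtain rfl : p = 43 := by omega
    obtain ⟨Φ, h1, h3⟩ := exists_stableLine_of_cert (IsogenyCert.check_of_checkFast checkFast_cert43)
      isCMTwistCert_cert43 cert43Cop checkCoprime_cert43 (by rw [show cert43Cop.ℓ = 10007 from rfl]; norm_num) (by norm_num)
      model43.2 (by rw [model43.1]; norm_num) (by norm_num) (by norm_num) W (by rw [h]; norm_num)
    exact ⟨Φ, h1, by rw [h3]; decide⟩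
  · -- j = -147197952000, p = 67
    obtain rfl : p = 67 := by omega
    obtain ⟨Φ, h1, h3⟩ := exists_stableLine_of_cert (IsogenyCert.check_of_checkFast checkFast_cert67)
      isCMTwistCert_cert67 cert67Cop checkCoprime_cert67 (by rw [show cert67Cop.ℓ = 10007 from rfl]; norm_num) (by norm_num)
      model67.2 (by rw [model67.1]; norm_num) (by norm_num) (by norm_num) W (by rw [h]; norm_num)
    exact ⟨Φ, h1, by rw [h3]; decide⟩
  · -- j = -262537412640768000, p = 163
    obtain rfl : p = 163 := by omega
    obtain ⟨Φ, h1, h3⟩ := exists_stableLine_of_cert (IsogenyCert.check_of_checkFast checkFast_cert163)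
      isCMTwistCert_cert163 cert163Cop checkCoprime_cert163 (by rw [show cert163Cop.ℓ = 10007 from rfl]; norm_num) (by norm_num)
      model163.2 (by rw [model163.1]; norm_num) (by norm_num) (by norm_num) W (by rw [h]; norm_num)
    exact ⟨Φ, h1, by rw [h3]; decide +kernel⟩

end Leaf

end Summit.BirchSwinnertonDyer.BirchSwinnertonDyer.Theorems.PrintCFram.RationalLine

end
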